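import Summits.BirchSwinnertonDyer.Rank1Residual.X5.TwoAdicTargetsMultEisenstein
import HarnessLib

/-!
# Class O1 (X5, `p = 2`, non-CM): the Eisenstein direction at a MULTIPLICATIVE `2`, part 2 — the
# split lower chain and the SHARP lower half `MissingLowerBoundAt W 2` from the typed target (PROVED)

HONEST FRAMING (cell `bsd-2adic`, run/shared/lean/pub/bsd-2adic/, FULL-BSD rank ≤ 1 programme
tranche 1b, D-0036; seat `bsd-2adic-mult-3`, D-0074 (A) row «find: 19923 `MultLowerHalfAtTwo`»):
research routes; no claim beyond the stated classes; nothing here is booked; no mark of RESIDUAL-MAP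
§I moves. Theorems only: 0 typed targets, 0 named facts. BSD is NOT proved by any of this. Continues
`X5/TwoAdicTargetsMultEisenstein.lean` (the typed target `O1.MultEisensteinDivisibilityAtTwo W` =
T-mult-4-int, the non-split lower chain, the reverse `κ₁`-inequality from Greenberg–Stevens at `2`).

* **`lowerBound_two_split_of_eisensteinDivisibility` (PROVED)** — the LOWER twin of G11a-split
  (`chainUpperAtTwoSplit_of_divisibilityRat`, `X5/TwoAdicTargetsSplitEnd.lean`): split `2`,
  `L(E,1) ≠ 0`, GZK, Greenberg's split display at `2` (`hEC`, A236 read at `2`), a Tate datum with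
  `log₂ q ≠ 0`, `X` torsion, `L(0) = 0`, the REVERSE `κ₁`-inequality
  `ord₂ [0]⁺_f + (ord₂ 𝓛₂(E) − 2) ≤ ord₂ c₁`, a non-zero rational `ϖ′` with `ord₂ ϖ ≤ ord₂ ϖ′ + k` and
  an Eisenstein datum `ι(T · f_X) = ι h · (ϖ′ · L)` for every generator `f_X` ⇒
  `∃ q, #Ш_an = q ∧ ord₂ q ≤ ord₂ #Ш + k`: deflate `L = T · L♭`, cancel `T`, `f_X(0) = h(0)·ϖ′·c₁`,
  `f_X(0)·#E(ℚ)(2)² = u·(𝓛₂/4)·2^{ord₂∏c}·#Sel`, `ord₂ h(0) ≥ 0`.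
* **`missingLowerBoundAt_two_nonsplit_of_multEisenstein`, `…_split_of_multEisenstein`,
  `missingLowerBoundAt_two_of_multEisenstein` (PROVED)** — on «analytic rank `0`, multiplicative at
  `2`» the typed target T-mult-4-int (at `ϖ′ = ϖ`, `k = 0`) delivers the SHARP lower half
  `MissingLowerBoundAt W 2` — the per-pair statement of the route item 19923 `MultLowerHalfAtTwo` —
  granted PRINT {Greenberg's displays at a non-split / split `2` read at `p = 2` (`hECns` / `hECsp`;
  fed by A235 / A236 through `twoAdicEulerCharRankZero{Nonsplit,Split}Mult_zero_of_greenberg`),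
  modularity (`hmod`), GZK (`hGZK`), Mahler–Manin (inside: `log₂ q_E ≠ 0`)} + `X(E/ℚ_∞)` torsion for
  the cyclotomic data (`hX`; clause (1) of K11a / K11b-Rat, `…_of_multRat`) + at a split `2` the
  Greenberg–Stevens formula `greenberg_stevens W 2` (`hGS`; cell memo PROOF-GS2, referee RC-4 PASS; a
  displayed hypothesis until converted). No image hypothesis, no `μ`, no period-integrality input
  (`ϖ` cancels), no slack.
* **`missingLowerBoundAt_two_of_multEisenstein_of_greenberg_of_multRat` (PROVED)** — the same with the
  displays fed by the literature named facts A235 / A236 and `hX` by the prime-uniform Kato binder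
  `KatoMultiplicativeDivisibilityRat W 2` (cell memo PROOF-MULT, RC-2 PASS): per pair on «r_an = 0,
  Mult@2» the inputs of the LOWER half are PRINT {A235, A236, modularity, GZK} + MEMO {Kato `⊗ℚ` at a
  multiplicative `2` (only `X` torsion is used), GS at `2`} + ONE research object, T-mult-4-int.

What this is NOT: not a proof of the route item (T-mult-4-int is OPEN, not in print at `2`); not a
class-level discharge; not rank `1`. The ∀-closure over «non-CM, r_an = 0, Mult@2» is the Theorems-side
bridge `Theorems/ByReductionTypeAtTwoMultLowerHalfInputs.lean`.

References: [GreenbergLNM1716] §4 pp. 112–113, §3 p. 94; [MazurTateTeitelbaum1986Invent] §I.10,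
§I.14–15, §II.1; [GreenbergStevens1993] Thm. of the Introduction (p ≥ 5; shape);
[Kobayashi2006DocMath] Cor. 4.2 (odd p; shape); [SilvermanATAEC1994] Thm. V.5.3;
[BarreSirieixDiazGramainPhilibert1996Manin] Thm. 1; [Miller2011LMS] Def. 1.1.
-/

set_option autoImplicit false

noncomputable section

open scoped Classical MatrixGroups ModularForm

open CongruenceSubgroup WeierstrassCurve Literature.NumberTheory.EllipticCurves
  Literature.NumberTheory.EllipticCurves.ModularForms
  Literature.NumberTheory.EllipticCurves.Greenberg1999
  Literature.NumberTheory.EllipticCurves.Wuthrich2014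
  Literature.NumberTheory.EllipticCurves.Rank1Residual
  Literature.NumberTheory.EllipticCurves.Rank1Residual.Typed
  Literature.NumberTheory.Transcendental

namespace Summit.BirchSwinnertonDyer.Rank1Residual.X5.O1

variable (W : WeierstrassCurve ℚ) [W.IsElliptic] [W.IsGloballyMinimal]

/-! ## §1 The LOWER twin of G11a-split: an Eisenstein datum at a split `2` bounds `#Ш_an` by `#Ш` -/

/-- **Lower chain at a SPLIT multiplicative `2` (PROVED).** Let `W` be globally minimal, split
multiplicative at `2` (`hmult`, `hsp`), `L(E,1) ≠ 0` (`hL`); GZK (`hGZK`); Greenberg's split display AT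
`2` (`hEC`, A236, `δ = 0`); a Tate datum `Dq` with `log₂ q ≠ 0`. Fix a cyclotomic datum, a newform `f`
of `E`, a power series `L` with `L(0) = 0` (`hL0`; the trivial zero) whose first coefficient
`c₁ = [T¹]L` satisfies the REVERSE `κ₁`-inequality `ord₂ [0]⁺_f + (ord₂ 𝓛₂(E) − 2) ≤ ord₂ c₁` (`hκ₁`;
Greenberg–Stevens at `2`, `kappaOne_ge_of_greenbergStevens`), a dual datum `D` with `X` torsion, the
period ratio `ϖ`, a non-zero rational `ϖ′` with `ord₂ ϖ ≤ ord₂ ϖ′ + k`, and an EISENSTEIN datum at the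
split prime: every generator `f_X` of `char_Λ X` satisfies `ι(T · f_X) = ι h · (ϖ′ · L)` for some
`h ∈ Λ`. Then `∃ q, #Ш_an = q ∧ ord₂ q ≤ ord₂ #Ш + k`. Proof: deflate `L = T · L♭`, cancel `T` in the
domain `ℚ₂⟦T⟧`: `ι f_X = ι h · (ϖ′ · L♭)`, so `f_X(0) = h(0)·ϖ′·c₁`; the split display
`f_X(0)·#E(ℚ)(2)² = u·(𝓛₂/4)·2^{ord₂∏c}·#Sel` and `ord₂ h(0) ≥ 0` give
`ord₂ ϖ′ + ord₂ c₁ + 2 ord₂ #E(ℚ)_tors ≤ (ord₂ 𝓛₂ − 2) + ord₂ ∏c + ord₂ #Ш`, and `hκ₁` trades `c₁` for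
`[0]⁺_f`. [cite: GreenbergLNM1716, §4 pp. 112–113 (analogue of Thm. 4.1, split l_v) and §3 p. 94]
[cite: MazurTateTeitelbaum1986Invent, §I.14–15 and §II.1] [cite: Miller2011LMS, Def. 1.1 and §1] -/
theorem lowerBound_two_split_of_eisensteinDivisibility
    (hEC : TwoAdicEulerCharRankZeroSplitMult W 0)
    (hGZK : rank_eq_analyticRank_of_analyticRank_le_one)
    (hmult : Mult W 2) (hsp : W.HasSplitMultiplicativeReductionAtPrime 2)
    (hL : W.entireLFunction 1 ≠ 0)
    {κ : ZpExtension ℚ 2} {γ : Field.absoluteGaloisGroup ℚ} {N : ℕ} [NeZero N]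
    {f : CuspForm (Gamma0 N) 2} (hκ : κ.IsCyclotomic) (hγ : κ.IsTopGenerator γ)
    (hγ' : IsCyclotomicVariable 2 γ) (hf : IsNewformOf W f)
    (Dq : TateParameterData W 2) (hlog : padicLog 2 Dq.q ≠ 0) {L : PowerSeries ℚ_[2]}
    (hL0 : PowerSeries.constantCoeff L = 0)
    (hκ₁ : padicValRat 2 (ratPlusSymbol f 0) + ((LInvariant Dq).valuation - 2) ≤
      (PowerSeries.coeff 1 L).valuation)
    (D : W.SelmerDualData κ γ) (hX : D.IsTorsion) (ϖ : ℚ)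
    (hϖ : (ϖ : ℝ) * W.realPeriodRat = plusPeriod f) {ϖ' : ℚ} (hϖ'0 : ϖ' ≠ 0) (k : ℕ)
    (hk : padicValRat 2 ϖ ≤ padicValRat 2 ϖ' + k)
    (hdiv : ∀ fE : IwasawaAlgebra 2, D.charIdeal = Ideal.span {fE} →
      ∃ h : IwasawaAlgebra 2, iwasawaToPowerSeries 2 (PowerSeries.X * fE) =
        iwasawaToPowerSeries 2 h * (PowerSeries.C (ϖ' : ℚ_[2]) * L)) :
    ∃ q : ℚ, shaAn W = (q : ℂ) ∧ padicValRat 2 q ≤ (padicValNat 2 W.shaOrder : ℤ) + k := by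
  -- Step 0: `t = ϖ · s = L(E,1)/Ω_E`, `s = [0]⁺_f ≠ 0`
  have hΩpos : 0 < W.realPeriodRat := W.realPeriodRat_pos_holds
  have hϖ0 : ϖ ≠ 0 := by
    rintro rfl
    have hper : 0 < plusPeriod f := IsNewform0.plusPeriod_pos_holds hf.1 hf.coeffField_eq_bot
    rw [← hϖ, Rat.cast_zero, zero_mul] at hper
    exact lt_irrefl _ hper
  set s : ℚ := ratPlusSymbol f 0 with hs_def
  set t : ℚ := ϖ * s with ht_def
  have hLval : W.entireLFunction 1 = (((s : ℝ) * plusPeriod f : ℝ) : ℂ) := hf.entireLFunction_one_eq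
  have hq : W.entireLFunction 1 / (W.realPeriodRat : ℂ) = ((t : ℚ) : ℂ) := by
    rw [hLval, ← hϖ, div_eq_iff (Complex.ofReal_ne_zero.mpr hΩpos.ne'), ht_def]
    push_cast
    ring
  have hs0 : s ≠ 0 := by
    intro h0
    apply hL
    rw [hLval, h0]
    simp
  have hvt : padicValRat 2 t = padicValRat 2 ϖ + padicValRat 2 s := by
    rw [ht_def, padicValRat.mul hϖ0 hs0]
  -- Step 1: finiteness from GZK (rank 0)
  obtain ⟨-, hE, hfin, hshaAn⟩ := shaAn_eq_of_L_one_div_eq hGZK W hL hq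
  haveI := hE
  haveI : Finite W.sha := hfin
  have hShapfin : Finite (AddCommGroup.primaryComponent W.sha 2) :=
    Finite.of_injective _ Subtype.val_injective
  have hSelfin : Finite (W.selmerGroupPInfty 2) :=
    (W.finite_selmerGroupPInfty_iff 2).mpr ⟨hE, hShapfin⟩
  haveI := hSelfin
  haveI : Module.Finite (IwasawaAlgebra 2) D.X := D.module_finite_holds hγ
  -- Step 2: a generator `fE` of `char X` and the Eisenstein cofactor `h`
  haveI : (Module.charIdeal (IwasawaAlgebra 2) D.X).IsPrincipal := charIdeal_isPrincipal_holds 2 D.X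
  obtain ⟨fE, hchar⟩ := Submodule.IsPrincipal.principal (Module.charIdeal (IwasawaAlgebra 2) D.X)
  have hchar' : D.charIdeal = Ideal.span {fE} := hchar
  obtain ⟨h, hιfE⟩ := hdiv fE hchar'
  -- Step 3: deflate `L = T · L♭`, cancel `T`: `ι fE = ι h · (ϖ′ · L♭)`, so `fE(0) = h(0) · ϖ′ · c₁`
  set Lf : PowerSeries ℚ_[2] := PowerSeries.mk fun n => PowerSeries.coeff (n + 1) L with hLf_def
  have hLX : L = PowerSeries.X * Lf := by
    conv_lhs => rw [PowerSeries.eq_X_mul_shift_add_const L]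
    rw [hL0, map_zero, add_zero]
  have hιfE' : iwasawaToPowerSeries 2 fE =
      iwasawaToPowerSeries 2 h * (PowerSeries.C (ϖ' : ℚ_[2]) * Lf) := by
    rw [map_mul, PowerSeries.map_X, hLX] at hιfE
    have h1 : PowerSeries.X * iwasawaToPowerSeries 2 fE =
        PowerSeries.X * (iwasawaToPowerSeries 2 h * (PowerSeries.C (ϖ' : ℚ_[2]) * Lf)) := by
      rw [hιfE]; ring
    exact mul_left_cancel₀ PowerSeries.X_ne_zero h1
  have hLf0 : PowerSeries.constantCoeff Lf = PowerSeries.coeff 1 L := by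
    rw [hLf_def, ← PowerSeries.coeff_zero_eq_constantCoeff_apply, PowerSeries.coeff_mk]
  set c₁ : ℚ_[2] := PowerSeries.coeff 1 L with hc₁_def
  set h0 : ℚ_[2] := ((PowerSeries.constantCoeff h : ℤ_[2]) : ℚ_[2]) with hh0
  have hfE0Q : ((PowerSeries.constantCoeff fE : ℤ_[2]) : ℚ_[2]) = h0 * ((ϖ' : ℚ_[2]) * c₁) := by
    rw [← constantCoeff_iwasawaToPowerSeries 2 fE, hιfE', map_mul, map_mul,
      PowerSeries.constantCoeff_C, hLf0, hh0, constantCoeff_iwasawaToPowerSeries 2 h]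
  have hϖ'Q0 : (ϖ' : ℚ_[2]) ≠ 0 := by exact_mod_cast hϖ'0
  have h20 : (2 : ℚ_[2]) ≠ 0 := two_ne_zero
  -- Step 4 (Greenberg's analogue of Thm. 4.1 at the split `2`, hypothesis `hEC`, slot `δ = 0`)
  obtain ⟨u₁, hu₁⟩ := hEC hmult hsp κ γ hκ hγ hγ' D hX fE hchar' hSelfin Dq hlog
  rw [add_zero, zpow_natCast] at hu₁
  -- Step 5 (the remaining bridges)
  haveI : NeZero (2 : ℕ) := ⟨two_ne_zero⟩
  obtain ⟨u₄, hu₄⟩ := exists_unit_torsionOrder_eq W 2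
  obtain ⟨u₅, hu₅⟩ := exists_unit_natCard_eq_mul_card_primaryComponent W.sha 2
  have hSel : Nat.card (W.selmerGroupPInfty 2) = Nat.card (AddCommGroup.primaryComponent W.sha 2) :=
    W.natCard_selmerGroupPInfty_eq_natCard_primaryComponent_sha 2
  set v := padicValNat 2 W.tamagawaProduct with hv
  set Tp : ℚ_[2] := (Nat.card (AddCommGroup.primaryComponent W.toAffine.Point 2) : ℚ_[2]) with hTp
  set Shp : ℚ_[2] := (Nat.card (AddCommGroup.primaryComponent W.sha 2) : ℚ_[2]) with hShp
  set ℓ4 : ℚ_[2] := LInvariant Dq / 4 with hℓ4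
  have hLI : LInvariant Dq ≠ 0 := LInvariant_ne_zero_holds Dq
  have h40 : (4 : ℚ_[2]) ≠ 0 := by norm_num
  have hℓ40 : ℓ4 ≠ 0 := by rw [hℓ4]; exact div_ne_zero hLI h40
  have hv2 : (2 : ℚ_[2]).valuation = 1 := by
    have h2 : ((2 : ℕ) : ℚ_[2]).valuation = 1 := Padic.valuation_p
    rwa [Nat.cast_ofNat] at h2
  have hv4 : (4 : ℚ_[2]).valuation = 2 := by
    rw [show (4 : ℚ_[2]) = 2 * 2 by norm_num, Padic.valuation_mul h20 h20, hv2]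
    norm_num
  have hvℓ4 : ℓ4.valuation = (LInvariant Dq).valuation - 2 := by
    rw [hℓ4, div_eq_mul_inv, Padic.valuation_mul hLI (inv_ne_zero h40), Padic.valuation_inv, hv4]
    ring
  have hu₄' : (W.torsionOrder : ℚ_[2]) = ((u₄ : ℤ_[2]) : ℚ_[2]) * Tp := by
    rw [hu₄, hTp]
    congr 1
    exact_mod_cast natCard_primaryComponent_point_congr W 2 _ _
  have hSha : (W.shaOrder : ℚ_[2]) = ((u₅ : ℤ_[2]) : ℚ_[2]) * Shp := by
    rw [WeierstrassCurve.shaOrder, hShp]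
    exact hu₅
  have hSel' : (Nat.card (W.selmerGroupPInfty 2) : ℚ_[2]) = Shp := by rw [hShp, hSel]
  have hTp0 : Tp ≠ 0 := by rw [hTp]; exact_mod_cast Nat.card_pos.ne'
  have hShp0 : Shp ≠ 0 := by rw [hShp]; exact_mod_cast Nat.card_pos.ne'
  -- `fE(0) ≠ 0` (the right-hand side of the display is non-zero), hence `h(0) ≠ 0`, `c₁ ≠ 0`
  have hfE00 : ((PowerSeries.constantCoeff fE : ℤ_[2]) : ℚ_[2]) ≠ 0 := by
    intro h0'
    have := hu₁
    rw [h0', zero_mul, hSel'] at this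
    exact (mul_ne_zero (mul_ne_zero (mul_ne_zero (coe_units_ne_zero 2 u₁) hℓ40)
      (pow_ne_zero _ h20)) hShp0) this.symm
  have hh0ne : h0 ≠ 0 := by
    intro h0'
    apply hfE00
    rw [hfE0Q, h0', zero_mul]
  have hc₁0 : c₁ ≠ 0 := by
    intro h0'
    apply hfE00
    rw [hfE0Q, h0', mul_zero, mul_zero]
  have hh0val : 0 ≤ h0.valuation := by
    rw [hh0]
    exact PadicInt.valuation_coe_nonneg
  -- Step 6: the identity `h0 · ϖ′ · c₁ · Tp² = u₁ · (𝓛/4) · 2^v · Shp` in `ℚ_2`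
  have key : h0 * (ϖ' : ℚ_[2]) * c₁ * Tp ^ 2 =
      ((u₁ : ℤ_[2]) : ℚ_[2]) * ℓ4 * (2 : ℚ_[2]) ^ v * Shp := by
    calc h0 * (ϖ' : ℚ_[2]) * c₁ * Tp ^ 2
        = ((PowerSeries.constantCoeff fE : ℤ_[2]) : ℚ_[2]) * Tp ^ 2 := by rw [hfE0Q]; ring
      _ = ((u₁ : ℤ_[2]) : ℚ_[2]) * ℓ4 * (2 : ℚ_[2]) ^ v *
            (Nat.card (W.selmerGroupPInfty 2) : ℚ_[2]) := hu₁
      _ = ((u₁ : ℤ_[2]) : ℚ_[2]) * ℓ4 * (2 : ℚ_[2]) ^ v * Shp := by rw [hSel']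
  -- Step 7: valuations
  have hvalL : (h0 * (ϖ' : ℚ_[2]) * c₁ * Tp ^ 2).valuation =
      h0.valuation + padicValRat 2 ϖ' + c₁.valuation + 2 * Tp.valuation := by
    rw [Padic.valuation_mul (mul_ne_zero (mul_ne_zero hh0ne hϖ'Q0) hc₁0) (pow_ne_zero 2 hTp0),
      Padic.valuation_mul (mul_ne_zero hh0ne hϖ'Q0) hc₁0, Padic.valuation_mul hh0ne hϖ'Q0,
      Padic.valuation_pow Tp, Padic.valuation_ratCast]
    push_cast
    ring
  have hvalR : (((u₁ : ℤ_[2]) : ℚ_[2]) * ℓ4 * (2 : ℚ_[2]) ^ v * Shp).valuation =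
      ℓ4.valuation + (v : ℤ) + Shp.valuation := by
    have hu₁0 : ((u₁ : ℤ_[2]) : ℚ_[2]) ≠ 0 := coe_units_ne_zero 2 u₁
    rw [Padic.valuation_mul (mul_ne_zero (mul_ne_zero hu₁0 hℓ40) (pow_ne_zero _ h20)) hShp0,
      Padic.valuation_mul (mul_ne_zero hu₁0 hℓ40) (pow_ne_zero _ h20),
      Padic.valuation_mul hu₁0 hℓ40, valuation_coe_units_eq_zero, Padic.valuation_pow, hv2]
    ring
  have hval := congrArg Padic.valuation key
  rw [hvalL, hvalR] at hval
  have hvT : Tp.valuation = (padicValNat 2 W.torsionOrder : ℤ) := by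
    have h' := congrArg Padic.valuation hu₄'
    rw [Padic.valuation_natCast, Padic.valuation_mul (coe_units_ne_zero 2 u₄) hTp0,
      valuation_coe_units_eq_zero, zero_add] at h'
    exact h'.symm
  have hvS : Shp.valuation = (padicValNat 2 W.shaOrder : ℤ) := by
    have h' := congrArg Padic.valuation hSha
    rw [Padic.valuation_natCast, Padic.valuation_mul (coe_units_ne_zero 2 u₅) hShp0,
      valuation_coe_units_eq_zero, zero_add] at h'
    exact h'.symm
  rw [hvT, hvS, hvℓ4] at hval
  -- `hκ₁` trades `c₁` for `s = [0]⁺_f`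
  have hκ₁' : padicValRat 2 s + ((LInvariant Dq).valuation - 2) ≤ c₁.valuation := hκ₁
  -- Step 8: Miller's currency `#Ш_an = t · #E(ℚ)² / ∏ c_ℓ`
  have ht0 : t ≠ 0 := mul_ne_zero hϖ0 hs0
  have hcard : (Nat.card W.toAffine.Point : ℚ) ≠ 0 := by
    exact_mod_cast (Nat.card_pos (α := W.toAffine.Point)).ne'
  have htam : (W.tamagawaProduct : ℚ) ≠ 0 := by
    exact_mod_cast (W.tamagawaProduct_pos_holds : 0 < W.tamagawaProduct).ne'
  have hcardT : (Nat.card W.toAffine.Point : ℚ) = (W.torsionOrder : ℚ) := by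
    exact_mod_cast (W.torsionOrder_eq_natCard_of_finite).symm
  refine ⟨t * (Nat.card W.toAffine.Point : ℚ) ^ 2 / (W.tamagawaProduct : ℚ), hshaAn, ?_⟩
  rw [padicValRat.div (mul_ne_zero ht0 (pow_ne_zero 2 hcard)) htam,
    padicValRat.mul ht0 (pow_ne_zero 2 hcard), padicValRat.pow, hcardT]
  simp only [padicValRat.of_nat, Nat.cast_ofNat]
  linarith


/-! ## §2 The typed target delivers `MissingLowerBoundAt W 2` on «analytic rank `0`, multiplicative at `2`» -/

/-- **T-mult-4-int ⇒ the SHARP LOWER half at a NON-SPLIT multiplicative `2`** (analytic rank `0`),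
granted Greenberg's non-split display at `2` (`hEC`), modularity (`hmod`), GZK (`hGZK`) and `X(E/ℚ_∞)`
torsion for the cyclotomic data (`hX`). The Néron `ϖ` cancels (`ϖ′ = ϖ`, `k = 0`); the `2`-adic
`L`-function with `α = −1` exists by `exists_isMultPAdicLFunctionOf_neg_one_of_nonsplit` (tree theorem).
[cite: GreenbergLNM1716, §4 pp. 112–113] [cite: Miller2011LMS, Def. 1.1 and §1] -/
theorem missingLowerBoundAt_two_nonsplit_of_multEisenstein
    (hEC : TwoAdicEulerCharRankZeroNonsplitMult W 0) (hmod : nonempty_modularParametrizationData)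
    (hGZK : rank_eq_analyticRank_of_analyticRank_le_one)
    (hX : ∀ (κ : ZpExtension ℚ 2) (γ : Field.absoluteGaloisGroup ℚ), κ.IsCyclotomic →
      κ.IsTopGenerator γ → IsCyclotomicVariable 2 γ → ∀ D : W.SelmerDualData κ γ, D.IsTorsion)
    (hr : W.analyticRank = 0) (hmult : Mult W 2) (hns : ¬ W.HasSplitMultiplicativeReductionAtPrime 2)
    (h : MultEisensteinDivisibilityAtTwo W) : MissingLowerBoundAt W 2 := by
  haveI : NeZero (W.conductorNorm ℤ) := ⟨(W.conductorNorm_pos_holds).ne'⟩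
  obtain ⟨Dm⟩ := hmod W
  have hf : IsNewformOf W Dm.f := Dm.isNewformOf
  have hL : W.entireLFunction 1 ≠ 0 :=
    (W.analyticRank_eq_zero_iff_holds hf.hasEntireLFunction).mp hr
  obtain ⟨ϖ, hϖpos, hϖeq, -⟩ := Dm.exists_rat_mul_realPeriodRat_eq_plusPeriod
  obtain ⟨κ, hκ, γ, hγ, hγ'⟩ := exists_isCyclotomic_isTopGenerator_isCyclotomicVariable_holds 2
  obtain ⟨D⟩ := W.nonempty_selmerDualData_holds κ γ hγ
  obtain ⟨L, hLf⟩ := exists_isMultPAdicLFunctionOf_neg_one_of_nonsplit hf hmult hns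
  obtain ⟨q, hq, hle⟩ := lowerBound_two_nonsplit_of_eisensteinDivisibility W hEC hGZK hmult hns hL hκ
    hγ hγ' hf hLf D (hX κ γ hκ hγ hγ' D) ϖ hϖeq hϖpos.ne' 0 (by simp)
    (fun fE hchar => (h κ γ hκ hγ hγ' hmult Dm.f hf ϖ hϖeq D fE hchar).1 hns L hLf)
  exact ⟨q, hq, by simpa using hle⟩

/-- **T-mult-4-int ⇒ the SHARP LOWER half at a SPLIT multiplicative `2`** (analytic rank `0`), granted
Greenberg's split display at `2` (`hEC`), modularity (`hmod`), GZK (`hGZK`), `X(E/ℚ_∞)` torsion for the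
cyclotomic data (`hX`), and the Greenberg–Stevens formula at `2` (`hGS`, for the reverse
`κ₁`-inequality and `L(0) = 0`). The Tate datum and `log₂ q_E ≠ 0` are discharged inside
(`nonempty_tateParameterData_iff_holds`, `TateParameterData.padicLog_q_ne_zero MahlerManinPadic_holds`);
the split `2`-adic `L`-function exists by `exists_isSplitMultPAdicLFunctionOf` (tree theorem).
[cite: GreenbergLNM1716, §4 pp. 112–113 and §3 p. 94] [cite: SilvermanATAEC1994, Thm. V.5.3]
[cite: Miller2011LMS, Def. 1.1 and §1] -/
theorem missingLowerBoundAt_two_split_of_multEisenstein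
    (hEC : TwoAdicEulerCharRankZeroSplitMult W 0) (hmod : nonempty_modularParametrizationData)
    (hGZK : rank_eq_analyticRank_of_analyticRank_le_one)
    (hX : ∀ (κ : ZpExtension ℚ 2) (γ : Field.absoluteGaloisGroup ℚ), κ.IsCyclotomic →
      κ.IsTopGenerator γ → IsCyclotomicVariable 2 γ → ∀ D : W.SelmerDualData κ γ, D.IsTorsion)
    (hGS : greenberg_stevens (W := W) (p := 2))
    (hr : W.analyticRank = 0) (hmult : Mult W 2) (hsp : W.HasSplitMultiplicativeReductionAtPrime 2)
    (h : MultEisensteinDivisibilityAtTwo W) : MissingLowerBoundAt W 2 := by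
  haveI : NeZero (W.conductorNorm ℤ) := ⟨(W.conductorNorm_pos_holds).ne'⟩
  obtain ⟨Dm⟩ := hmod W
  have hf : IsNewformOf W Dm.f := Dm.isNewformOf
  have hL : W.entireLFunction 1 ≠ 0 :=
    (W.analyticRank_eq_zero_iff_holds hf.hasEntireLFunction).mp hr
  obtain ⟨ϖ, hϖpos, hϖeq, -⟩ := Dm.exists_rat_mul_realPeriodRat_eq_plusPeriod
  obtain ⟨κ, hκ, γ, hγ, hγ'⟩ := exists_isCyclotomic_isTopGenerator_isCyclotomicVariable_holds 2
  obtain ⟨D⟩ := W.nonempty_selmerDualData_holds κ γ hγ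
  obtain ⟨L, hLf⟩ := exists_isSplitMultPAdicLFunctionOf hsp hf
  obtain ⟨Dq⟩ := (nonempty_tateParameterData_iff_holds (W := W) (p := 2)).mpr hsp
  have hlog : padicLog 2 Dq.q ≠ 0 := Dq.padicLog_q_ne_zero MahlerManinPadic_holds
  obtain ⟨q, hq, hle⟩ := lowerBound_two_split_of_eisensteinDivisibility W hEC hGZK hmult hsp hL hκ hγ
    hγ' hf Dq hlog hLf.constantCoeff_eq_zero (kappaOne_ge_of_greenbergStevens W hGS hr hf hLf Dq) D
    (hX κ γ hκ hγ hγ' D) ϖ hϖeq hϖpos.ne' 0 (by simp)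
    (fun fE hchar => (h κ γ hκ hγ hγ' hmult Dm.f hf ϖ hϖeq D fE hchar).2 hsp L hLf)
  exact ⟨q, hq, by simpa using hle⟩

/-- **T-mult-4-int ⇒ `MissingLowerBoundAt W 2` at a MULTIPLICATIVE `2`, both signs** (analytic rank
`0`): by cases split / non-split over the two consumers. Inputs: the two displays at `2` (`hECns`,
`hECsp`), modularity, GZK, `X` torsion (`hX`), at a split `2` Greenberg–Stevens (`hGS`), and the typed
target. This is the per-pair form of the route item `MultLowerHalfAtTwo` (stmt-BirchSwinnertonDyer-19923)
modulo its displayed inputs. [cite: GreenbergLNM1716, §4 pp. 112–113] [cite: Miller2011LMS, Def. 1.1 and §1] -/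
theorem missingLowerBoundAt_two_of_multEisenstein
    (hECns : TwoAdicEulerCharRankZeroNonsplitMult W 0) (hECsp : TwoAdicEulerCharRankZeroSplitMult W 0)
    (hmod : nonempty_modularParametrizationData)
    (hGZK : rank_eq_analyticRank_of_analyticRank_le_one)
    (hX : ∀ (κ : ZpExtension ℚ 2) (γ : Field.absoluteGaloisGroup ℚ), κ.IsCyclotomic →
      κ.IsTopGenerator γ → IsCyclotomicVariable 2 γ → ∀ D : W.SelmerDualData κ γ, D.IsTorsion)
    (hGS : W.HasSplitMultiplicativeReductionAtPrime 2 → greenberg_stevens (W := W) (p := 2))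
    (hr : W.analyticRank = 0) (hmult : Mult W 2) (h : MultEisensteinDivisibilityAtTwo W) :
    MissingLowerBoundAt W 2 := by
  by_cases hsp : W.HasSplitMultiplicativeReductionAtPrime 2
  · exact missingLowerBoundAt_two_split_of_multEisenstein W hECsp hmod hGZK hX (hGS hsp) hr hmult hsp h
  · exact missingLowerBoundAt_two_nonsplit_of_multEisenstein W hECns hmod hGZK hX hr hmult hsp h

/-- **The per-pair LOWER half on «r_an = 0, Mult@2» from PRINT + MEMO + T-mult-4-int (PROVED).** The
displays at `2` fed by the literature named facts A235 (`h41ns`,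
`thm41Analogue_charValue_rankZero_numberField_anyPrime`) and A236 (`h41sp`,
`thm41Analogue_charValue_rankZero_split_baseChange_anyPrime`); `X` torsion fed by the prime-uniform
Kato binder `KatoMultiplicativeDivisibilityRat W 2` (clause (1); cell memo PROOF-MULT Thm. A/B);
modularity, GZK; Greenberg–Stevens at a split `2` (`hGS`, memo PROOF-GS2); and the ONE research
object `MultEisensteinDivisibilityAtTwo W`. [cite: GreenbergLNM1716, §4 pp. 112–113]
[cite: Kato2004Asterisque, Thm. 17.4 (1) (p. 273) (X torsion; shape at p ∣ N)] [cite: Miller2011LMS, Def. 1.1 and §1] -/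
theorem missingLowerBoundAt_two_of_multEisenstein_of_greenberg_of_multRat
    (h41ns : thm41Analogue_charValue_rankZero_numberField_anyPrime)
    (h41sp : thm41Analogue_charValue_rankZero_split_baseChange_anyPrime)
    (hmod : nonempty_modularParametrizationData)
    (hGZK : rank_eq_analyticRank_of_analyticRank_le_one)
    (hKato : KatoMultiplicativeDivisibilityRat W 2)
    (hGS : W.HasSplitMultiplicativeReductionAtPrime 2 → greenberg_stevens (W := W) (p := 2))
    (hr : W.analyticRank = 0) (hmult : Mult W 2) (h : MultEisensteinDivisibilityAtTwo W) :
    MissingLowerBoundAt W 2 := by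
  haveI : NeZero (W.conductorNorm ℤ) := ⟨(W.conductorNorm_pos_holds).ne'⟩
  obtain ⟨Dm⟩ := hmod W
  have hf : IsNewformOf W Dm.f := Dm.isNewformOf
  exact missingLowerBoundAt_two_of_multEisenstein W
    (twoAdicEulerCharRankZeroNonsplitMult_zero_of_greenberg W h41ns)
    (twoAdicEulerCharRankZeroSplitMult_zero_of_greenberg W h41sp) hmod hGZK
    (fun κ γ hκ hγ hγ' D => (hKato κ γ hκ hγ hγ' hmult Dm.f hf D).1) hGS hr hmult h

end Summit.BirchSwinnertonDyer.Rank1Residual.X5.O1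

end
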